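import Mathlib
import Summits.NavierStokesRegularity.NavierStokesRegularity.Theorems.AxisTwistDoorTiltDominationLocNeckCircle
import Summits.NavierStokesRegularity.NavierStokesRegularity.Theorems.AxisTwistDoorTiltDominationLocSliceEnergy
import HarnessLib

/-!
# AxisTwistDoor · crux `TiltDominationLoc` (stmt-NavierStokesRegularity-26991) · birth skeleton STUB 1
# `stub_neckLength` — A ONE-SIGNED SINGULAR PROFILE IS A NECK OF PARABOLIC LENGTH (assembly)

From part A (`…TiltDominationLocNeckCircle.lintegral_ball_ge_neck`: `(c²/(2π)) log(R/ρ)·|heights| ≤ ∫_{B(·,2R)}|v(s)|²`)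
and part B (`…TiltDominationLocSliceEnergy.exists_sliceEnergy_bound`: `∫_{B(·,2R)}|v(s)|² ≤ A″R`): the statement
`StubNeckLength` of ns-idea-6's birth skeleton with `NeckBound` unfolded VERBATIM, `A = 2πA″` (the skeleton's Props
live in the planner's file, not in the tree; there `stub_neckLength : StubNeckLength := neckLength`).

Seat ns-el-k1b g0.  WHAT THIS IS NOT: not a statement about Navier–Stokes regularity and not the crux
`TiltDominationLoc` (XL, research): its provable-first stub only. [cite: AlbrittonBarker2019, §1; KochNadirashviliSereginSverak2009, §5]
-/

noncomputable section

-- the summit and its single sub-problem share the name (CONVENTIONS §1), as in every Theorems file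
set_option linter.dupNamespace false

namespace Summit.NavierStokesRegularity.NavierStokesRegularity.Theorems.TiltDominationLoc.NeckLength

open scoped Topology InnerProductSpace NNReal ENNReal
open Set Function MeasureTheory Filter Metric
open Literature.Analysis Literature.Analysis.FluidPDE
open Summit.NavierStokesRegularity.NavierStokesRegularity.Theorems.LocalSineTubeDoorProfileAlignedWindowRigidityAncient
  (continuous_slice bdd_of_hasTypeITimeDecay)
open Summit.NavierStokesRegularity.NavierStokesRegularity.Theorems.TiltDominationLoc.SliceEnergy (exists_sliceEnergy_bound)

/-! ### the stub -/

/-- **STUB 1 `stub_neckLength` of the `TiltDominationLoc` birth skeleton (statement `StubNeckLength` with `NeckBound`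
unfolded VERBATIM).**  A ONE-SIGNED SINGULAR PROFILE IS A NECK OF PARABOLIC LENGTH: for every profile of the
route's energy class there is `A ≥ 0` such that for all `s < 0`, `c > 0`, `0 < ρ < R`, `z₀`, the set of heights
`z` with `|z − z₀| < R` at which the axis circulation stays `≥ c` for all radii in `(ρ, R)` has measure
`≤ A·R/(c² log(R/ρ))` (steps (1)–(3): `A = 2π A″`).  In the skeleton: `stub_neckLength : StubNeckLength := neckLength`.
[cite: AlbrittonBarker2019, §1 (A ≤ 𝐈); KochNadirashviliSereginSverak2009, §5] -/
theorem neckLength :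
    ∀ (C : ℝ) (v : ℝ → EuclideanSpace ℝ (Fin 3) → EuclideanSpace ℝ (Fin 3)) (π : ℝ → EuclideanSpace ℝ (Fin 3) → ℝ) (H : ℝ → EuclideanSpace ℝ (Fin 3) → EuclideanSpace ℝ (Fin 3) →L[ℝ] EuclideanSpace ℝ (Fin 3)), Literature.Analysis.FluidPDE.HasTypeITimeDecay C v → ContinuousOn (Function.uncurry v) (Set.Iio (0 : ℝ) ×ˢ Set.univ) → (∀ s t : ℝ, s < t → t < 0 → ∀ x, v t x = Literature.Analysis.UnboundedOperators.heatExtension (v s) (t - s) x - Literature.Analysis.FluidPDE.oseenDuhamel 1 s v v t x) → (∀ t < 0, Literature.Analysis.FluidPDE.VectorCalculus.IsDivFree (v t)) → Literature.Analysis.FluidPDE.IsSuitableWeakSolutionOn (Literature.Analysis.FluidPDE.slab (EuclideanSpace ℝ (Fin 3)) (Set.Iio (0 : ℝ)) isOpen_Iio) 1 0 v π → Literature.Analysis.FluidPDE.HasWeakSpatialGradientOn (Literature.Analysis.FluidPDE.slab (EuclideanSpace ℝ (Fin 3)) (Set.Iio (0 : ℝ)) isOpen_Iio) v H → Literature.Analysis.FluidPDE.typeIBound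 (Set.Iio (0 : ℝ) ×ˢ Set.univ) v π H < ⊤ →
      ∃ A : ℝ, 0 ≤ A ∧ ∀ s < 0, ∀ (c ρ R z₀ : ℝ), 0 < c → 0 < ρ → ρ < R →
        MeasureTheory.volume {z : ℝ | |z - z₀| < R ∧ ∀ r : ℝ, ρ < r → r < R → c ≤ ∫ θ in (0 : ℝ)..(2 * Real.pi), ⟪v s (WithLp.toLp 2 ![r * Real.cos θ, r * Real.sin θ, z] : EuclideanSpace ℝ (Fin 3)), (WithLp.toLp 2 ![-Real.sin θ, Real.cos θ, 0] : EuclideanSpace ℝ (Fin 3))⟫_ℝ * r}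
          ≤ ENNReal.ofReal (A * R / (c ^ 2 * Real.log (R / ρ))) := by
  intro C v π H hrate hcont _hmild _hdiv _hsw _hwg hI
  obtain ⟨A'', hA'', hE⟩ := exists_sliceEnergy_bound hrate hcont hI
  refine ⟨2 * Real.pi * A'', by positivity, fun s hs c ρ R z₀ hc hρ hρR => ?_⟩
  have hR : 0 < R := hρ.trans hρR
  have hlog : 0 < Real.log (R / ρ) := Real.log_pos ((one_lt_div hρ).2 hρR)
  set K : ℝ := c ^ 2 / (2 * Real.pi) * Real.log (R / ρ) with hK
  have hK0 : 0 < K := by positivity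
  have h1 := lintegral_ball_ge_neck (continuous_slice hcont hs) hc hρ hρR z₀
  have h2 := hE s hs R hR (WithLp.toLp 2 ![0, 0, z₀])
  have h3 : ENNReal.ofReal K * _ ≤ ENNReal.ofReal (A'' * R) := h1.trans h2
  have hKne : ENNReal.ofReal K ≠ 0 := (ENNReal.ofReal_pos.2 hK0).ne'
  calc MeasureTheory.volume _ ≤ ENNReal.ofReal (A'' * R) / ENNReal.ofReal K := by
        rw [ENNReal.le_div_iff_mul_le (Or.inl hKne) (Or.inl ENNReal.ofReal_ne_top), mul_comm]
        exact h3
    _ = ENNReal.ofReal (A'' * R / K) := (ENNReal.ofReal_div_of_pos hK0).symm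
    _ = ENNReal.ofReal (2 * Real.pi * A'' * R / (c ^ 2 * Real.log (R / ρ))) := by
        congr 1
        rw [hK]
        field_simp

end Summit.NavierStokesRegularity.NavierStokesRegularity.Theorems.TiltDominationLoc.NeckLength

end
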